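import Summits.BirchSwinnertonDyer.BirchSwinnertonDyer.Theorems.KimAtThreeShallowEqDeepTwistInjective
import Summits.BirchSwinnertonDyer.BirchSwinnertonDyer.Theorems.KimAtThreeDeepUpperRiderOfCompat
import HarnessLib

/-!
# Route `KimAtThreeKolyvagin` (W2): gen 9's TWISTED rider (ii_τ) of the good (anomalous allowed) rows DERIVED from a
# φ-level Euler-factor compatibility clause — the scalar is recovered through the INJECTIVITY of the twist
# operator, with NO digit lost

Cell `bsd-addord`, seat `bsd-addord-w2-c4` (gen 10; owner of crux 19599 `ShallowEqDeepOffKatoStratum`, item 19077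
`ShallowEqDeepAtTorsionFree`).  `--supports` 19599.  HONEST FRAMING: TOOL theorem with DISPLAYED hypotheses (no
definition, no named fact, no `sorry`); Kato's value datum `Λ`, the scalar dual exponential `φ` at `ℚ₃` and the
normalised functional `φ″` are ABSTRACT binders; closes nothing; nothing booked; BSD is not proved by any of this.

## What, and why
Seat w2-c3's `rider₂_of_compat` derives acc6's two-exponent rider from the crude compatibility
«`3^b·(φ(h) ⊗ 1 − Λ_{0,r}(y)) ∈ 3^{j+1}·L_int`» by a coordinate functional; on a good ANOMALOUS row that road
loses a digit (gens 8–9).  Gen 9's (C1_τ) displays instead the twisted rider (ii_τ): premise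
«`3•Λ_{0,r}(y) − (s·(3 − a₃ + 1)) ⊗ 1 ∈ 3^{j+1}·Tw_{P_w} L_int`», `Tw_{P_w} l = Σ_g (P_w)_g • (1 ⊗ σ_g) l`,
`P_w = 3 − a₃δ_w + δ_{w²}` (`w·[3] = 1`), conclusion «`Λfin_j(loc κ₀) = s̄`».  THIS FILE derives (ii_τ) from the
φ-level TWISTED compatibility COMPAT_τ «`∃ l ∈ L_int, 3•(φ(h) ⊗ 1 − Λ_{0,r}(y)) = 3^{j+1} • Tw_{P_w} l`» (TRUE for
Kato's `Λ = exp*` on a good row: the LATTICE LEMMA `exp*_ω(H¹(K,T)) = E₃(φ⁻¹)𝓞_K`, memo W2C4-ANOMALOUS-PORT-g9 §2)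
and the interface of a functional `φ″ = u·φ` with `u·(4 − a₃) = 3` (`φ″ = exp*_ω/E₃(1)`).  Mechanism (memo g10
§2(g), §7): adding premise and COMPAT_τ gives `(3φ(h) − s(4 − a₃)) ⊗ 1 = 3^{j+1}·Tw(l₁ + l₂)`; the left side is
`Tw((φ″(h) − s) ⊗ 1)` (`Tw` acts on `ℚ₃ ⊗ 1` by `4 − a₃`), so by INJECTIVITY of `Tw`
(`KimAtThreeShallowEqDeepTwistInjective.twist_injective`, `a₃² < 12`) `(φ″(h) − s) ⊗ 1 ∈ 3^{j+1}L_int`, and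
w2-c3's coordinate functional (`toZModPow_eq_of_sub_eq_smul_cycIntLattice`) yields `φ″(h) ≡ s`.
* §1 `twist_add_right`, `twist_sub_right`, `twist_smul_right` — `Tw_P` is `ℤ₃`-linear in the vector.
* §2 **`riderτ_of_compatτ`** — RIDERτ⟦W, j, v₃, a₃, Λ, Λfin_j⟧ from the interface of `φ″` and COMPAT_τ at depth `j`.
References: [Kim2022StructureSelmer] §3.2.3, Lemma 3.4, Cor. 3.5, §3.4.1, proof of Thm. 3.13; [BlochKato1990] §3;
[Kato2004Asterisque] §9.4, Thm. 9.7; memo HOME/w2c4/W2C4-MULT-TWOEXP-g10.md §7.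
-/

set_option autoImplicit false
-- the Theorems namespace of a single-conjunct summit repeats the summit name by design (D-0017)
set_option linter.dupNamespace false

noncomputable section

open scoped Classical NumberField TensorProduct ContRepresentation
open Field NumberField IsDedekindDomain
open WeierstrassCurve Literature.NumberTheory.EllipticCurves Literature.NumberTheory.GaloisRepresentations
  Literature.NumberTheory.GaloisRepresentations.DiscreteGaloisModule Literature.NumberTheory.GaloisCohomology
open Literature.NumberTheory.EllipticCurves.Kato2004 Literature.NumberTheory.EllipticCurves.Kato2004.EulerSystemValues
open Summit.BirchSwinnertonDyer.Rank1Residual.GaloisImage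
open Summit.BirchSwinnertonDyer.BirchSwinnertonDyer.Theorems
open Summit.BirchSwinnertonDyer.BirchSwinnertonDyer.Theorems.KimAtThreeShallowEqDeepTwistInjective
open Summit.BirchSwinnertonDyer.BirchSwinnertonDyer.Theorems.KimAtThreeDeepUpperRiderOfCompat

namespace Summit.BirchSwinnertonDyer.BirchSwinnertonDyer.Theorems.KimAtThreeShallowEqDeepAnomalousRiderOfCompat

/-! ### §1 The twist operator is `ℤ_p`-linear in the vector -/

section Twist

variable (p : ℕ) [Fact p.Prime] (n : ℕ) [NeZero n]

/-- Local notation: the twist operator `Tw_P v = Σ_g P_g • (1 ⊗ σ_g) v`. -/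
local notation3 "𝐓𝐰⟦" P ", " v "⟧" => ∑ g : (ZMod n)ˣ, ((MonoidAlgebra.coeff P g : ℤ_[p]) : ℚ_[p]) •
  Algebra.TensorProduct.map (AlgHom.id ℚ ℚ_[p]) (sigma n g : CyclotomicField n ℚ →ₐ[ℚ] CyclotomicField n ℚ) v

/-- `Tw_P (v + v′) = Tw_P v + Tw_P v′`. [folklore] -/
theorem twist_add_right (P : MonoidAlgebra ℤ_[p] (ZMod n)ˣ) (v v' : ℚ_[p] ⊗[ℚ] CyclotomicField n ℚ) :
    𝐓𝐰⟦P, v + v'⟧ = 𝐓𝐰⟦P, v⟧ + 𝐓𝐰⟦P, v'⟧ := by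
  rw [← Finset.sum_add_distrib]
  refine Finset.sum_congr rfl fun g _ => ?_
  rw [map_add, smul_add]

/-- `Tw_P (v − v′) = Tw_P v − Tw_P v′`. [folklore] -/
theorem twist_sub_right (P : MonoidAlgebra ℤ_[p] (ZMod n)ˣ) (v v' : ℚ_[p] ⊗[ℚ] CyclotomicField n ℚ) :
    𝐓𝐰⟦P, v - v'⟧ = 𝐓𝐰⟦P, v⟧ - 𝐓𝐰⟦P, v'⟧ := by
  rw [← Finset.sum_sub_distrib]
  refine Finset.sum_congr rfl fun g _ => ?_
  rw [map_sub, smul_sub]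

/-- `Tw_P (r • v) = r • Tw_P v` for `r ∈ ℤ_p`. [folklore] -/
theorem twist_smul_right (P : MonoidAlgebra ℤ_[p] (ZMod n)ˣ) (r : ℤ_[p]) (v : ℚ_[p] ⊗[ℚ] CyclotomicField n ℚ) :
    𝐓𝐰⟦P, r • v⟧ = r • 𝐓𝐰⟦P, v⟧ := by
  rw [Finset.smul_sum]
  refine Finset.sum_congr rfl fun g _ => ?_
  rw [KimAtThreePortSharedSATCore.padicInt_smul_eq_coe_smul, tensorSigma_smul, smul_comm,
    KimAtThreePortSharedSATCore.padicInt_smul_eq_coe_smul]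

end Twist

/-! ### §2 The twisted rider from the twisted compatibility -/

section Rider

/-- Local notation: the TWISTED rider clause (ii_τ) at depth `j`, place `v`, integer model `t₃` of `a₃`, for
the pair `(Λ, Λf)` (this seat's gen 9, VERBATIM). -/
local notation3 (prettyPrint := false) "RIDERτ⟦" W' ", " j ", " v' ", " t3 ", " Λ' ", " Λf "⟧" =>
  ∀ (r : Finset (HeightOneSpectrum (𝓞 ℚ))) (w : (ZMod (cycLevel 3 0 r))ˣ),
    (w : ZMod (cycLevel 3 0 r)) * ((3 : ℕ) : ZMod (cycLevel 3 0 r)) = 1 →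
    ∀ (Ψ : H1 (tateRep W' 3) (cycSubgroup 3 0 r) →+
        continuousCohomology 1
          (subgroupRep (WeierstrassCurve.torsionGaloisModule W' (((3 : ℕ) : ℤ) ^ j * ((3 : ℕ) : ℤ))).toTopRep
            (cycSubgroup 3 0 r))),
      (∀ (φ : contOneCocycles (subgroupRep (tateRep W' 3).toTopRep (cycSubgroup 3 0 r)))
          (ψ : contOneCocycles
            (subgroupRep (WeierstrassCurve.torsionGaloisModule W' (((3 : ℕ) : ℤ) ^ j * ((3 : ℕ) : ℤ))).toTopRep
              (cycSubgroup 3 0 r))),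
          (∀ g, ((ψ.1 g : geomTorsion W' (((3 : ℕ) : ℤ) ^ j * ((3 : ℕ) : ℤ))) : geomPoints W') =
            TateModule.proj 3 (j + 1) (φ.1 g)) →
          Ψ (oneCocycleClass _ φ) = oneCocycleClass _ ψ) →
      ∀ (y : H1 (tateRep W' 3) (cycSubgroup 3 0 r))
        (κ₀ : galoisCohomology (WeierstrassCurve.torsionGaloisModule W' (((3 : ℕ) : ℤ) ^ j * ((3 : ℕ) : ℤ))) 1)
        (s : ℤ_[3]),
        resSubgroup (WeierstrassCurve.torsionGaloisModule W' (((3 : ℕ) : ℤ) ^ j * ((3 : ℕ) : ℤ))).toTopRep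
            (cycSubgroup 3 0 r) 1 κ₀ = Ψ y →
        galoisCohomology.localization (WeierstrassCurve.torsionGaloisModule W' (((3 : ℕ) : ℤ) ^ j * ((3 : ℕ) : ℤ)))
            (Sum.inr v') 1 κ₀ ∈ propagatedSelmerStructure W' 3 j (Sum.inr v') →
        (∃ l ∈ cycIntLattice 3 (cycLevel 3 0 r),
            ((3 : ℕ) : ℤ_[3]) • Λ' 0 r y -
                (((s * (((3 : ℕ) : ℤ_[3]) - (t3 : ℤ_[3]) + 1) : ℤ_[3]) : ℚ_[3]) ⊗ₜ[ℚ]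
                  (1 : CyclotomicField (cycLevel 3 0 r) ℚ)) =
              ((3 : ℤ_[3]) ^ (j + 1)) • ∑ g : (ZMod (cycLevel 3 0 r))ˣ,
                ((((((3 : ℕ) : MonoidAlgebra ℤ_[3] (ZMod (cycLevel 3 0 r))ˣ)) -
                    MonoidAlgebra.single w (t3 : ℤ_[3]) +
                    MonoidAlgebra.single (w ^ 2) (1 : ℤ_[3])).coeff g : ℤ_[3]) : ℚ_[3]) •
                  Algebra.TensorProduct.map (AlgHom.id ℚ ℚ_[3])
                    (sigma (cycLevel 3 0 r) g : CyclotomicField (cycLevel 3 0 r) ℚ →ₐ[ℚ]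
                      CyclotomicField (cycLevel 3 0 r) ℚ) l) →
        Λf (galoisCohomology.localization (WeierstrassCurve.torsionGaloisModule W' (((3 : ℕ) : ℤ) ^ j * ((3 : ℕ) : ℤ)))
            (Sum.inr v') 1 κ₀) = PadicInt.toZModPow (j + 1) s

/-- Local notation: the TWISTED compatibility COMPAT_τ at depth `j` between `Λ_{0,r}` and `φ` (place `v`, model
`t₃`): «`3•(φ(h) ⊗ 1 − Λ_{0,r}(y)) ∈ 3^{j+1}·Tw_{P_w} L_int`» for every `T`-lift `h` of `loc_v κ₀`, `res κ₀ = Ψ y`,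
and every `w` with `w·[3] = 1`. -/
local notation3 (prettyPrint := false) "COMPATτ⟦" W' ", " j ", " v' ", " t3 ", " Λ' ", " φ0 "⟧" =>
  ∀ (r : Finset (HeightOneSpectrum (𝓞 ℚ))) (w : (ZMod (cycLevel 3 0 r))ˣ),
    (w : ZMod (cycLevel 3 0 r)) * ((3 : ℕ) : ZMod (cycLevel 3 0 r)) = 1 →
    ∀ (Ψ : H1 (tateRep W' 3) (cycSubgroup 3 0 r) →+
      continuousCohomology 1 (subgroupRep
        (WeierstrassCurve.torsionGaloisModule W' (((3 : ℕ) : ℤ) ^ j * ((3 : ℕ) : ℤ))).toTopRep (cycSubgroup 3 0 r))),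
    (∀ (φ₁ : contOneCocycles (subgroupRep (tateRep W' 3).toTopRep (cycSubgroup 3 0 r)))
        (ψ : contOneCocycles (subgroupRep
          (WeierstrassCurve.torsionGaloisModule W' (((3 : ℕ) : ℤ) ^ j * ((3 : ℕ) : ℤ))).toTopRep (cycSubgroup 3 0 r))),
        (∀ g, ((ψ.1 g : geomTorsion W' (((3 : ℕ) : ℤ) ^ j * ((3 : ℕ) : ℤ))) : geomPoints W') =
          TateModule.proj 3 (j + 1) (φ₁.1 g)) →
        Ψ (oneCocycleClass _ φ₁) = oneCocycleClass _ ψ) →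
    ∀ (y : H1 (tateRep W' 3) (cycSubgroup 3 0 r))
      (κ₀ : galoisCohomology (WeierstrassCurve.torsionGaloisModule W' (((3 : ℕ) : ℤ) ^ j * ((3 : ℕ) : ℤ))) 1)
      (h : (tateLocalRep W' 3 (Sum.inr v')).cohomology 1),
      resSubgroup (WeierstrassCurve.torsionGaloisModule W' (((3 : ℕ) : ℤ) ^ j * ((3 : ℕ) : ℤ))).toTopRep
          (cycSubgroup 3 0 r) 1 κ₀ = Ψ y →
      galoisCohomology.localization (WeierstrassCurve.torsionGaloisModule W' (((3 : ℕ) : ℤ) ^ j * ((3 : ℕ) : ℤ)))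
          (Sum.inr v') 1 κ₀ = tateLocalMap W' 3 j (Sum.inr v') h →
      ∃ l ∈ cycIntLattice 3 (cycLevel 3 0 r),
        ((3 : ℕ) : ℤ_[3]) • ((φ0 h ⊗ₜ[ℚ] (1 : CyclotomicField (cycLevel 3 0 r) ℚ)) - Λ' 0 r y) =
          ((3 : ℤ_[3]) ^ (j + 1)) • ∑ g : (ZMod (cycLevel 3 0 r))ˣ,
            ((((((3 : ℕ) : MonoidAlgebra ℤ_[3] (ZMod (cycLevel 3 0 r))ˣ)) -
                MonoidAlgebra.single w (t3 : ℤ_[3]) +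
                MonoidAlgebra.single (w ^ 2) (1 : ℤ_[3])).coeff g : ℤ_[3]) : ℚ_[3]) •
              Algebra.TensorProduct.map (AlgHom.id ℚ ℚ_[3])
                (sigma (cycLevel 3 0 r) g : CyclotomicField (cycLevel 3 0 r) ℚ →ₐ[ℚ]
                  CyclotomicField (cycLevel 3 0 r) ℚ) l

variable (W : WeierstrassCurve ℚ) [W.IsElliptic] [ContinuousSMul ℤ_[3] (W.tateModule 3)]
  (v₃ : HeightOneSpectrum (𝓞 ℚ))
  (Λ : ∀ (k' : ℕ) (r : Finset (HeightOneSpectrum (𝓞 ℚ))),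
    H1 (tateRep W 3) (cycSubgroup 3 k' r) →ₗ[ℤ_[3]] ℚ_[3] ⊗[ℚ] CyclotomicField (cycLevel 3 k' r) ℚ)
  (φ φ'' : (tateLocalRep W 3 (Sum.inr v₃)).cohomology 1 →+ ℚ_[3])

set_option backward.isDefEq.respectTransparency false in
/-- **RIDERτ⟦W, j, v₃, a₃, Λ, Λfin_j⟧ DERIVED** from: the interface of a NORMALISED functional `φ″`
(`φ″(y) = s ⇒ Λfin_j(π_{j+1,*} y) = s mod 3^{j+1}`), the relation `φ″ = u·φ` with `u·(4 − a₃) = 3` (for Kato: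
`φ″ = exp*_ω/E₃(1)`), `a₃² < 12` (Hasse), and the TWISTED φ-level compatibility COMPAT_τ at depth `j` (DISPLAYED).
Proof: lift `loc κ₀` to `h`; add premise and COMPAT_τ: `(3φ(h) − s(4 − a₃)) ⊗ 1 = 3^{j+1}•Tw(l₁ + l₂)`; the left
side is `Tw((φ″(h) − s) ⊗ 1)`; `Tw` is injective (`twist_injective`), so `(φ″(h) − s) ⊗ 1 = 3^{j+1}•(l₁ + l₂)`
with `l₁ + l₂ ∈ L_int`, and seat w2-c3's coordinate functional gives `φ″(h) ≡ s (mod 3^{j+1})`.  NO digit is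
lost (contrast: the untwisted crude road gives only `3φ″ ≡ 3s`).  Nothing about `exp*` is constructed.
[cite: Kim2022StructureSelmer, Lemma 3.4, Cor. 3.5 and the proof of Thm. 3.13 (arXiv v3 pp. 17–18, 26–27)]
[cite: BlochKato1990, §3 (Prop. 3.8, Ex. 3.11)] [cite: Kato2004Asterisque, §9.4 (p. 188) and Thm. 9.7 (p. 189)] -/
theorem riderτ_of_compatτ {t₃ : ℤ} (ht₃ : t₃ ^ 2 < 12) (u : ℚ_[3])
    (hu : u * (((4 : ℤ) - t₃ : ℤ) : ℚ_[3]) = 3)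
    (hφ'' : ∀ y, φ'' y = u * φ y) (hint'' : ∀ y, ‖φ'' y‖ ≤ 1)
    (j : ℕ)
    (Λfin : galoisCohomology ((W.torsionGaloisModule (((3 : ℕ) : ℤ) ^ j * ((3 : ℕ) : ℤ))).toLocal
      (Sum.inr v₃)) 1 →+ ZMod (3 ^ (j + 1)))
    (hI : ∀ (y : (tateLocalRep W 3 (Sum.inr v₃)).cohomology 1) (s : ℤ_[3]), φ'' y = s →
      Λfin (tateLocalMap W 3 j (Sum.inr v₃) y) = PadicInt.toZModPow (j + 1) s)
    (hcompat : COMPATτ⟦W, j, v₃, t₃, Λ, φ⟧) :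
    RIDERτ⟦W, j, v₃, t₃, Λ, Λfin⟧ := by
  intro r w hw Ψ hΨ y κ₀ s hres hloc hprem
  obtain ⟨h, hh⟩ := (mem_propagatedSelmerStructure_iff W 3 j (Sum.inr v₃) _).mp hloc
  obtain ⟨l₂, hl₂, hc⟩ := hcompat r w hw Ψ hΨ y κ₀ h hres hh.symm
  obtain ⟨l₁, hl₁, hs⟩ := hprem
  -- the integer `φ″(h)`
  set sh : ℤ_[3] := ⟨φ'' h, hint'' h⟩ with hsh
  have hφ''h : φ'' h = (sh : ℚ_[3]) := rfl
  rw [← hh, hI h sh hφ''h]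
  -- it suffices: `(sh - s) ⊗ 1 ∈ 3^{j+1} L_int` (w2-c3's coordinate functional)
  refine toZModPow_eq_of_sub_eq_smul_cycIntLattice 3 (cycLevel 3 0 r)
    (v := ((s : ℚ_[3]) ⊗ₜ[ℚ] (1 : CyclotomicField (cycLevel 3 0 r) ℚ))) ?_
    ⟨0, (cycIntLattice 3 (cycLevel 3 0 r)).zero_mem, by rw [sub_self, smul_zero]⟩
  refine ⟨l₁ + l₂, (cycIntLattice 3 (cycLevel 3 0 r)).add_mem hl₁ hl₂, ?_⟩
  -- abbreviations
  set K := CyclotomicField (cycLevel 3 0 r) ℚ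
  set P : MonoidAlgebra ℤ_[3] (ZMod (cycLevel 3 0 r))ˣ :=
    ((3 : ℕ) : MonoidAlgebra ℤ_[3] (ZMod (cycLevel 3 0 r))ˣ) - MonoidAlgebra.single w (t₃ : ℤ_[3]) +
      MonoidAlgebra.single (w ^ 2) (1 : ℤ_[3]) with hP
  have hP1 : (((4 : ℤ) - t₃ : ℤ) : ℚ_[3]) ≠ 0 := by
    have h4 : (4 : ℤ) - t₃ ≠ 0 := by
      intro h0
      have : t₃ = 4 := by omega
      rw [this] at ht₃; norm_num at ht₃
    exact_mod_cast h4
  -- (1) the sum of premise and compatibility: `(3 φ h − s(4 − t₃)) ⊗ 1 = 3^{j+1} • Tw (l₁ + l₂)`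
  have hsum : (((3 : ℚ_[3]) * φ h - (s : ℚ_[3]) * (((4 : ℤ) - t₃ : ℤ) : ℚ_[3])) ⊗ₜ[ℚ] (1 : K)) =
      ((3 : ℤ_[3]) ^ (j + 1)) •
        ∑ g : (ZMod (cycLevel 3 0 r))ˣ, ((P.coeff g : ℤ_[3]) : ℚ_[3]) •
          Algebra.TensorProduct.map (AlgHom.id ℚ ℚ_[3]) (sigma (cycLevel 3 0 r) g : K →ₐ[ℚ] K) (l₁ + l₂) := by
    rw [twist_add_right, smul_add, ← hs, ← hc]
    set C : ℚ_[3] ⊗[ℚ] K := (1 : ℚ_[3]) ⊗ₜ[ℚ] (1 : K) with hC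
    have e1 : ∀ x : ℚ_[3], x ⊗ₜ[ℚ] (1 : K) = x • C := fun x => by
      rw [hC, TensorProduct.smul_tmul', smul_eq_mul, mul_one]
    have h3s : ∀ X : ℚ_[3] ⊗[ℚ] K, ((3 : ℕ) : ℤ_[3]) • X = (3 : ℚ_[3]) • X := fun X => by
      rw [KimAtThreePortSharedSATCore.padicInt_smul_eq_coe_smul, PadicInt.coe_natCast, Nat.cast_ofNat]
    have hcast : ((s * (((3 : ℕ) : ℤ_[3]) - (t₃ : ℤ_[3]) + 1) : ℤ_[3]) : ℚ_[3]) =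
        (s : ℚ_[3]) * (3 - (t₃ : ℚ_[3]) + 1) := by
      rw [PadicInt.coe_mul, PadicInt.coe_add, PadicInt.coe_sub, PadicInt.coe_natCast, PadicInt.coe_intCast,
        PadicInt.coe_one, Nat.cast_ofNat]
    simp only [e1]
    rw [h3s, h3s, hcast, Int.cast_sub, Int.cast_ofNat]
    module
  -- (2) the left side is `Tw ((sh − s) ⊗ 1)`
  have hdiff : ((sh : ℚ_[3]) - (s : ℚ_[3])) * (((4 : ℤ) - t₃ : ℤ) : ℚ_[3]) =
      (3 : ℚ_[3]) * φ h - (s : ℚ_[3]) * (((4 : ℤ) - t₃ : ℤ) : ℚ_[3]) := by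
    rw [← hφ''h, hφ'' h, sub_mul, mul_assoc, mul_comm (φ h), ← mul_assoc, hu]
  have htw : ∑ g : (ZMod (cycLevel 3 0 r))ˣ, ((P.coeff g : ℤ_[3]) : ℚ_[3]) •
        Algebra.TensorProduct.map (AlgHom.id ℚ ℚ_[3]) (sigma (cycLevel 3 0 r) g : K →ₐ[ℚ] K)
          ((((sh : ℚ_[3]) - (s : ℚ_[3])) ⊗ₜ[ℚ] (1 : K))) =
      (((3 : ℚ_[3]) * φ h - (s : ℚ_[3]) * (((4 : ℤ) - t₃ : ℤ) : ℚ_[3])) ⊗ₜ[ℚ] (1 : K)) := by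
    rw [hP, twist_tmul_one, TensorProduct.smul_tmul', smul_eq_mul, mul_comm, hdiff]
  -- (3) injectivity of `Tw`
  have hzero : ∑ g : (ZMod (cycLevel 3 0 r))ˣ, ((P.coeff g : ℤ_[3]) : ℚ_[3]) •
        Algebra.TensorProduct.map (AlgHom.id ℚ ℚ_[3]) (sigma (cycLevel 3 0 r) g : K →ₐ[ℚ] K)
          ((((sh : ℚ_[3]) - (s : ℚ_[3])) ⊗ₜ[ℚ] (1 : K)) - ((3 : ℤ_[3]) ^ (j + 1)) • (l₁ + l₂)) = 0 := by
    rw [twist_sub_right, twist_smul_right, htw, hsum, sub_self]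
  rw [hP] at hzero
  have hinj := twist_injective 3 (cycLevel 3 0 r) w t₃ ht₃ _ hzero
  rw [sub_eq_zero, TensorProduct.sub_tmul] at hinj
  rw [Nat.cast_ofNat]
  exact hinj

end Rider

end Summit.BirchSwinnertonDyer.BirchSwinnertonDyer.Theorems.KimAtThreeShallowEqDeepAnomalousRiderOfCompat

end
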